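import Summits.CriticalPhenomena.PercolationContinuityZ3.Theorems.PercNearOneGluingAdditiveGluingQ9Line
import Summits.CriticalPhenomena.PercolationContinuityZ3.Theorems.PercNearOneGluingAdditiveGluingQuantLemma5
import Summits.CriticalPhenomena.PercolationContinuityZ3.Theorems.PercNearOneGluingAdditiveGluingBlockKernelPairClosure
import Summits.CriticalPhenomena.PercolationContinuityZ3.Theorems.PercNearOneGluingAdditiveGluingBlockGoodDelMin
import HarnessLib

/-! # Crux `PercNearOneGluing.AdditiveGluing` (stmt-CriticalPhenomena-4576) — `AdditiveGluing` from LEAF-COMPLETENESS (invested seat xfam-a)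

Lands `--supports stmt-CriticalPhenomena-4576`; no definitions, no named facts.

**LC (leaf-completeness)** is the following induction-free statement about ONE residual instance — a weighting `u`, relays `A ∋ b`, a bad block
`S` (`|S| ≥ 2`, disjoint from `A`, `4 ≤ A.card`), the pre-gluing minimiser `a₀`, drift, a selection `sel` — : at least one of five explicit
inequalities holds ("some leaf applies"):
 (T0) `μ_{u/S}(a₀ ↔ b) ≤ μ_u(S ↔ b)`;
 (Lδ) for some `v ∈ S` with `μ_u(a₀ ↮ v) > 0`:  `(μ_u(a₀↔b) − μ_u(v↔b))⁺ · μ_{u/S}(a₀ ↮ v) ≤ μ_u(a₀ ↮ v) · POCK` (`POCK` = the kernel's pocket sum);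
 (ND) `a₀` minimises `μ_{u/S}(· ↔ b)` over `A`;
 (SW) for some block vertex `x` and some `a' ∈ A` minimising `μ(· ↔ b)` over `A` in `u/S` with the star of `x` killed: `μ_{u/S}(a₀↔b) ≤ μ_{u/S}(a'↔b)`;
 (DM) `a₀` minimises `μ_{u−S}(· ↔ b)` and every outside neighbour of the block is at least as `u−S`-reliable as `a₀` (seat xfam-b's leaf).
* `residualKernelQ9_of_LC : LC → hres9`: each disjunct discharges the residual kernel with the Q9 induction hypothesis — (T0) `blockKernel_pocketFree`,
  (Lδ) the QUANTITATIVE Lemma 5 `gluingLemma5_quant` (this seat), (ND) `blockGood_leaf_ih` with goodness of the glued quadruple from its Q9 goodness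
  (`good_of_q9`), (SW) the Q9 hypothesis for the glued block observed from `x` + the switching leaf `blockKernel_of_designated`, (DM) `blockGood_leaf_delMin`.
* **`additiveGluing_of_LC : LC → AdditiveGluing`** (by `additiveGluing_of_residualKernelQ9`).  So the crux — and with it the Kozma–Nitzan chain of this
  route — is reduced BY NAME to LC.  Numerically (seat note `Cruxes/AdditiveGluing/XfamA-Q9-residual.md` §4, exact partition DP, n ≤ 8, 3–5 relays, adversarial
  annealing on "all five fail"): no instance where all five fail by more than 5·10⁻⁵ was found; every limit point of the annealer is an exact relay tie with
  kernel slack → 0.  Without (SW) in its genuine Q9 form, or without (Lδ), explicit failures exist (seat notes) — both are needed.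
[cite: KozmaNitzan2024, §3.2 (Lemma 5 p. 13, Thms 4–5 pp. 12–14), Question 9 (p. 36)]
-/

namespace Summit.CriticalPhenomena.PercolationContinuityZ3.Theorems

open MeasureTheory Set
open Literature.Probability.LatticeModels (prodBernoulli)
open Literature.Probability.Percolation (BondConfig openConn openConnIn openGraph openCluster)
open scoped BigOperators

noncomputable section
open Classical

section LC

open Filter
open Literature.Probability.LatticeModels Literature.Probability.Percolation

variable {n : ℕ}

/-- **The (Lδ) leaf.**  If for some `v ∈ S ∌ b` with `μ_u(a₀ ↮ v) > 0` the pocket sum pays the error of the quantitative Lemma 5,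
`(μ_u(a₀↔b) − μ_u(v↔b))⁺ · μ_{u/S}(a₀ ↮ v) ≤ μ_u(a₀ ↮ v) · POCK`, then the block kernel holds. [cite: KozmaNitzan2024, §3.2 Lemma 5 (p. 13)] -/
theorem blockKernel_of_quantLemma5 (u : Sym2 (Fin n) → unitInterval) (A S : Finset (Fin n)) (b a₀ v : Fin n)
    (sel : Finset (Fin n) → Fin n) (hvS : v ∈ S) (hbS : b ∉ S)
    (hN : (prodBernoulli u).real (openConn a₀ v)ᶜ ≠ 0)
    (hpay : max ((prodBernoulli u).real (openConn a₀ b) - (prodBernoulli u).real (openConn v b)) 0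
        * (prodBernoulli (fun e : Sym2 (Fin n) => if (∀ x ∈ e, x ∈ S) ∧ ¬ e.IsDiag then 1 else u e)).real (openConn a₀ v)ᶜ ≤
      (prodBernoulli u).real (openConn a₀ v)ᶜ * (∑ W ∈ (Finset.univ : Finset (Finset (Fin n))).filter (fun W => Disjoint W A),
              (prodBernoulli u).real {ω : BondConfig (Fin n) | ∀ z : Fin n, (z ∈ W ↔ ω ∈ ⋃ s ∈ S, openConn s z)}
                * (prodBernoulli u).real (openConnIn ((W : Set (Fin n))ᶜ) (sel W) b))) :
      (prodBernoulli u).real (openConn a₀ b)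
          + (prodBernoulli u).real ((openConn a₀ b)ᶜ ∩ (⋃ s ∈ S, openConn a₀ s) ∩ (⋃ s ∈ S, openConn s b))
        ≤ (prodBernoulli u).real (⋃ s ∈ S, openConn s b)
          + ∑ W ∈ (Finset.univ : Finset (Finset (Fin n))).filter (fun W => Disjoint W A),
              (prodBernoulli u).real {ω : BondConfig (Fin n) | ∀ z : Fin n, (z ∈ W ↔ ω ∈ ⋃ s ∈ S, openConn s z)}
                * (prodBernoulli u).real (openConnIn ((W : Set (Fin n))ᶜ) (sel W) b) := by
  have hq := gluingLemma5_quant n u S a₀ v b hvS hbS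
  have hNpos : 0 < (prodBernoulli u).real ((openConn a₀ v)ᶜ : Set (BondConfig (Fin n))) :=
    lt_of_le_of_ne measureReal_nonneg (Ne.symm hN)
  have hv_le : (prodBernoulli (fun e : Sym2 (Fin n) => if (∀ x ∈ e, x ∈ S) ∧ ¬ e.IsDiag then 1 else u e)).real (openConn v b) ≤
      (prodBernoulli (fun e : Sym2 (Fin n) => if (∀ x ∈ e, x ∈ S) ∧ ¬ e.IsDiag then 1 else u e)).real (⋃ s ∈ S, openConn s b) :=
    measureReal_mono (fun ω hω => Set.mem_iUnion₂.2 ⟨v, hvS, hω⟩) (measure_ne_top _ _)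
  rw [← blockGrowth_glue_real_openConn, ← blockGrowth_glue_real_iUnion u S b]
  -- divide the quantitative Lemma 5 by `μ_u(a₀ ↮ v) > 0`
  have key : (prodBernoulli u).real (openConn a₀ v)ᶜ *
      (prodBernoulli (fun e : Sym2 (Fin n) => if (∀ x ∈ e, x ∈ S) ∧ ¬ e.IsDiag then 1 else u e)).real (openConn a₀ b) ≤
      (prodBernoulli u).real (openConn a₀ v)ᶜ *
        ((prodBernoulli (fun e : Sym2 (Fin n) => if (∀ x ∈ e, x ∈ S) ∧ ¬ e.IsDiag then 1 else u e)).real (⋃ s ∈ S, openConn s b) + (∑ W ∈ (Finset.univ : Finset (Finset (Fin n))).filter (fun W => Disjoint W A),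
              (prodBernoulli u).real {ω : BondConfig (Fin n) | ∀ z : Fin n, (z ∈ W ↔ ω ∈ ⋃ s ∈ S, openConn s z)}
                * (prodBernoulli u).real (openConnIn ((W : Set (Fin n))ᶜ) (sel W) b))) := by
    nlinarith [hq, hpay, hv_le, hNpos]
  exact le_of_mul_le_mul_left key hNpos

/-- **The residual kernel with the Q9 induction hypothesis follows from leaf-completeness.** [cite: KozmaNitzan2024, §3.2 (Thms 4–5 pp. 12–14)] -/
theorem residualKernelQ9_of_LC
    (hLC : ∀ (n : ℕ) (u : Sym2 (Fin n) → unitInterval) (A S : Finset (Fin n)) (b a₀ : Fin n)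
      (sel : Finset (Fin n) → Fin n),
      b ∈ A → Disjoint S A → 2 ≤ S.card → 4 ≤ A.card → (∀ W, sel W ∈ A) → a₀ ∈ A →
      (∀ a ∈ A, (prodBernoulli u).real (openConn a₀ b) ≤ (prodBernoulli u).real (openConn a b)) →
      (∀ v ∈ S, (prodBernoulli u).real (openConn v b) < (prodBernoulli u).real (openConn a₀ b)) →
      (∃ a ∈ A, (prodBernoulli (fun e : Sym2 (Fin n) => if (∀ x ∈ e, x ∈ S) ∧ ¬ e.IsDiag then 1 else u e)).real (openConn a b) <
        (prodBernoulli (fun e : Sym2 (Fin n) => if (∀ x ∈ e, x ∈ S) ∧ ¬ e.IsDiag then 1 else u e)).real (openConn a₀ b)) →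
      (  -- (T0) pocket-free
        (prodBernoulli (fun e : Sym2 (Fin n) => if (∀ x ∈ e, x ∈ S) ∧ ¬ e.IsDiag then 1 else u e)).real (openConn a₀ b) ≤ (prodBernoulli u).real (⋃ s ∈ S, openConn s b))
      ∨ (-- (Lδ) quantitative Lemma 5: the pockets pay the scaled badness gap of some block vertex
        ∃ v ∈ S, (prodBernoulli u).real (openConn a₀ v)ᶜ ≠ 0 ∧
          max ((prodBernoulli u).real (openConn a₀ b) - (prodBernoulli u).real (openConn v b)) 0
              * (prodBernoulli (fun e : Sym2 (Fin n) => if (∀ x ∈ e, x ∈ S) ∧ ¬ e.IsDiag then 1 else u e)).real (openConn a₀ v)ᶜ ≤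
            (prodBernoulli u).real (openConn a₀ v)ᶜ * (∑ W ∈ (Finset.univ : Finset (Finset (Fin n))).filter (fun W => Disjoint W A),
              (prodBernoulli u).real {ω : BondConfig (Fin n) | ∀ z : Fin n, (z ∈ W ↔ ω ∈ ⋃ s ∈ S, openConn s z)}
                * (prodBernoulli u).real (openConnIn ((W : Set (Fin n))ᶜ) (sel W) b)))
      ∨ (-- (ND) no drift: a₀ minimises the glued two-point function
        ∀ a ∈ A, (prodBernoulli (fun e : Sym2 (Fin n) => if (∀ x ∈ e, x ∈ S) ∧ ¬ e.IsDiag then 1 else u e)).real (openConn a₀ b) ≤ (prodBernoulli (fun e : Sym2 (Fin n) => if (∀ x ∈ e, x ∈ S) ∧ ¬ e.IsDiag then 1 else u e)).real (openConn a b))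
      ∨ (-- (SW) switching: the glued block observed from a vertex x ∈ S, designated at a minimiser after killing the star of x
        ∃ x ∈ S, ∃ a' ∈ A,
          (∀ a ∈ A, (prodBernoulli (fun e : Sym2 (Fin n) => if x ∈ e then (0 : unitInterval) else (fun e : Sym2 (Fin n) => if (∀ x ∈ e, x ∈ S) ∧ ¬ e.IsDiag then 1 else u e) e)).real (openConn a' b) ≤ (prodBernoulli (fun e : Sym2 (Fin n) => if x ∈ e then (0 : unitInterval) else (fun e : Sym2 (Fin n) => if (∀ x ∈ e, x ∈ S) ∧ ¬ e.IsDiag then 1 else u e) e)).real (openConn a b)) ∧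
          (prodBernoulli (fun e : Sym2 (Fin n) => if (∀ x ∈ e, x ∈ S) ∧ ¬ e.IsDiag then 1 else u e)).real (openConn a₀ b) ≤ (prodBernoulli (fun e : Sym2 (Fin n) => if (∀ x ∈ e, x ∈ S) ∧ ¬ e.IsDiag then 1 else u e)).real (openConn a' b))
      ∨ (-- (DM) deletion minimiser (seat xfam-b's leaf): a₀ minimal after deleting the block, the block's neighbours reliable there
        (∀ a ∈ A, (prodBernoulli (fun e : Sym2 (Fin n) => if ∃ y ∈ S, y ∈ e then (0 : unitInterval) else u e)).real (openConn a₀ b) ≤ (prodBernoulli (fun e : Sym2 (Fin n) => if ∃ y ∈ S, y ∈ e then (0 : unitInterval) else u e)).real (openConn a b)) ∧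
        (∀ s ∈ S, ∀ z : Fin n, z ∉ S → (u s(s, z) : ℝ) ≠ 0 →
          (prodBernoulli (fun e : Sym2 (Fin n) => if ∃ y ∈ S, y ∈ e then (0 : unitInterval) else u e)).real (openConn a₀ b) ≤ (prodBernoulli (fun e : Sym2 (Fin n) => if ∃ y ∈ S, y ∈ e then (0 : unitInterval) else u e)).real (openConn z b)))) :
    ∀ (n : ℕ) (u : Sym2 (Fin n) → unitInterval) (A S : Finset (Fin n)) (b a₀ : Fin n)
      (sel : Finset (Fin n) → Fin n),
      b ∈ A → Disjoint S A → 2 ≤ S.card → 4 ≤ A.card → (∀ W, sel W ∈ A) → a₀ ∈ A →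
      (∀ a ∈ A, (prodBernoulli u).real (openConn a₀ b) ≤ (prodBernoulli u).real (openConn a b)) →
      (∀ v ∈ S, (prodBernoulli u).real (openConn v b) < (prodBernoulli u).real (openConn a₀ b)) →
      (∃ a ∈ A, (prodBernoulli (fun e : Sym2 (Fin n) => if (∀ x ∈ e, x ∈ S) ∧ ¬ e.IsDiag then 1 else u e)).real (openConn a b) <
        (prodBernoulli (fun e : Sym2 (Fin n) => if (∀ x ∈ e, x ∈ S) ∧ ¬ e.IsDiag then 1 else u e)).real (openConn a₀ b)) →
      (∀ w' : Sym2 (Fin n) → unitInterval,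
        (Finset.univ.filter (fun v : Fin n => ∃ z : Fin n, 0 < (w' s(z, v) : ℝ))).card ≤
          (Finset.univ.filter (fun v : Fin n => ∃ z : Fin n,
            0 < ((fun e : Sym2 (Fin n) => if (∀ x ∈ e, x ∈ S) ∧ ¬ e.IsDiag then 1 else u e) s(z, v) : ℝ))).card →
        ∀ (A' : Finset (Fin n)) (o' b' : Fin n), b' ∈ A' → o' ∉ A' →
        ∀ c₀ : Fin n, c₀ ∈ A' →
          (∀ c ∈ A', (prodBernoulli (fun e : Sym2 (Fin n) => if o' ∈ e then (0 : unitInterval) else w' e)).real (openConn c₀ b') ≤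
            (prodBernoulli (fun e : Sym2 (Fin n) => if o' ∈ e then (0 : unitInterval) else w' e)).real (openConn c b')) →
          ∀ sel' : Finset (Fin n) → Fin n, (∀ W', sel' W' ∈ A') →
          (prodBernoulli w').real (openConn c₀ b') ≤
            (prodBernoulli w').real (openConn o' b')
              + ∑ W' ∈ (Finset.univ : Finset (Finset (Fin n))).filter (fun W' => o' ∈ W' ∧ Disjoint W' A'),
                  (prodBernoulli w').real {ω : BondConfig (Fin n) | openCluster ω o' = (W' : Set (Fin n))}
                    * (prodBernoulli w').real (openConnIn ((W' : Set (Fin n))ᶜ) (sel' W') b')) →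
      (prodBernoulli u).real (openConn a₀ b)
          + (prodBernoulli u).real ((openConn a₀ b)ᶜ ∩ (⋃ s ∈ S, openConn a₀ s) ∩ (⋃ s ∈ S, openConn s b))
        ≤ (prodBernoulli u).real (⋃ s ∈ S, openConn s b)
          + ∑ W ∈ (Finset.univ : Finset (Finset (Fin n))).filter (fun W => Disjoint W A),
              (prodBernoulli u).real {ω : BondConfig (Fin n) | ∀ z : Fin n, (z ∈ W ↔ ω ∈ ⋃ s ∈ S, openConn s z)}
                * (prodBernoulli u).real (openConnIn ((W : Set (Fin n))ᶜ) (sel W) b) := by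
  intro n u A S b a₀ sel hb hSA h2 hA4 hsel ha₀ hmin hbad hdrift IH9
  obtain ⟨s₀, hs₀⟩ := Finset.card_pos.1 (lt_of_lt_of_le zero_lt_two h2)
  have hs₀A : s₀ ∉ A := Finset.disjoint_left.1 hSA hs₀
  have hbS : b ∉ S := fun h => Finset.disjoint_left.1 hSA h hb
  rcases hLC n u A S b a₀ sel hb hSA h2 hA4 hsel ha₀ hmin hbad hdrift with hT0 | ⟨v, hvS, hN, hpay⟩ | hND | ⟨x, hxS, a', ha', hmin', hle⟩ | ⟨hminR, hnbr⟩
  · exact blockKernel_pocketFree u A S b a₀ sel hT0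
  · exact blockKernel_of_quantLemma5 u A S b a₀ v sel hvS hbS hN hpay
  · have hQg := IH9 (fun e : Sym2 (Fin n) => if (∀ x ∈ e, x ∈ S) ∧ ¬ e.IsDiag then 1 else u e) le_rfl A s₀ b hb hs₀A
    exact blockGood_leaf_ih u A S b a₀ s₀ sel hs₀ hb hsel hND (good_of_q9 _ A s₀ b hb hQg)
  · have hxA : x ∉ A := Finset.disjoint_left.1 hSA hxS
    have hQg := IH9 (fun e : Sym2 (Fin n) => if (∀ x ∈ e, x ∈ S) ∧ ¬ e.IsDiag then 1 else u e) le_rfl A x b hb hxA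
    exact blockKernel_of_designated u A S b a₀ a' x sel hxS hle (hQg a' ha' hmin' sel hsel)
  · exact blockGood_leaf_delMin u A S b a₀ sel hb ha₀ hSA hsel hminR hnbr

/-- **`AdditiveGluing` from LEAF-COMPLETENESS** — the crux BY NAME reduced to LC. [cite: KozmaNitzan2024, §3.2 (Thms 4–5 pp. 12–14), Question 9 (p. 36)] -/
theorem additiveGluing_of_LC
    (hLC : ∀ (n : ℕ) (u : Sym2 (Fin n) → unitInterval) (A S : Finset (Fin n)) (b a₀ : Fin n)
      (sel : Finset (Fin n) → Fin n),
      b ∈ A → Disjoint S A → 2 ≤ S.card → 4 ≤ A.card → (∀ W, sel W ∈ A) → a₀ ∈ A →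
      (∀ a ∈ A, (prodBernoulli u).real (openConn a₀ b) ≤ (prodBernoulli u).real (openConn a b)) →
      (∀ v ∈ S, (prodBernoulli u).real (openConn v b) < (prodBernoulli u).real (openConn a₀ b)) →
      (∃ a ∈ A, (prodBernoulli (fun e : Sym2 (Fin n) => if (∀ x ∈ e, x ∈ S) ∧ ¬ e.IsDiag then 1 else u e)).real (openConn a b) <
        (prodBernoulli (fun e : Sym2 (Fin n) => if (∀ x ∈ e, x ∈ S) ∧ ¬ e.IsDiag then 1 else u e)).real (openConn a₀ b)) →
      (  -- (T0) pocket-free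
        (prodBernoulli (fun e : Sym2 (Fin n) => if (∀ x ∈ e, x ∈ S) ∧ ¬ e.IsDiag then 1 else u e)).real (openConn a₀ b) ≤ (prodBernoulli u).real (⋃ s ∈ S, openConn s b))
      ∨ (-- (Lδ) quantitative Lemma 5: the pockets pay the scaled badness gap of some block vertex
        ∃ v ∈ S, (prodBernoulli u).real (openConn a₀ v)ᶜ ≠ 0 ∧
          max ((prodBernoulli u).real (openConn a₀ b) - (prodBernoulli u).real (openConn v b)) 0
              * (prodBernoulli (fun e : Sym2 (Fin n) => if (∀ x ∈ e, x ∈ S) ∧ ¬ e.IsDiag then 1 else u e)).real (openConn a₀ v)ᶜ ≤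
            (prodBernoulli u).real (openConn a₀ v)ᶜ * (∑ W ∈ (Finset.univ : Finset (Finset (Fin n))).filter (fun W => Disjoint W A),
              (prodBernoulli u).real {ω : BondConfig (Fin n) | ∀ z : Fin n, (z ∈ W ↔ ω ∈ ⋃ s ∈ S, openConn s z)}
                * (prodBernoulli u).real (openConnIn ((W : Set (Fin n))ᶜ) (sel W) b)))
      ∨ (-- (ND) no drift: a₀ minimises the glued two-point function
        ∀ a ∈ A, (prodBernoulli (fun e : Sym2 (Fin n) => if (∀ x ∈ e, x ∈ S) ∧ ¬ e.IsDiag then 1 else u e)).real (openConn a₀ b) ≤ (prodBernoulli (fun e : Sym2 (Fin n) => if (∀ x ∈ e, x ∈ S) ∧ ¬ e.IsDiag then 1 else u e)).real (openConn a b))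
      ∨ (-- (SW) switching: the glued block observed from a vertex x ∈ S, designated at a minimiser after killing the star of x
        ∃ x ∈ S, ∃ a' ∈ A,
          (∀ a ∈ A, (prodBernoulli (fun e : Sym2 (Fin n) => if x ∈ e then (0 : unitInterval) else (fun e : Sym2 (Fin n) => if (∀ x ∈ e, x ∈ S) ∧ ¬ e.IsDiag then 1 else u e) e)).real (openConn a' b) ≤ (prodBernoulli (fun e : Sym2 (Fin n) => if x ∈ e then (0 : unitInterval) else (fun e : Sym2 (Fin n) => if (∀ x ∈ e, x ∈ S) ∧ ¬ e.IsDiag then 1 else u e) e)).real (openConn a b)) ∧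
          (prodBernoulli (fun e : Sym2 (Fin n) => if (∀ x ∈ e, x ∈ S) ∧ ¬ e.IsDiag then 1 else u e)).real (openConn a₀ b) ≤ (prodBernoulli (fun e : Sym2 (Fin n) => if (∀ x ∈ e, x ∈ S) ∧ ¬ e.IsDiag then 1 else u e)).real (openConn a' b))
      ∨ (-- (DM) deletion minimiser (seat xfam-b's leaf): a₀ minimal after deleting the block, the block's neighbours reliable there
        (∀ a ∈ A, (prodBernoulli (fun e : Sym2 (Fin n) => if ∃ y ∈ S, y ∈ e then (0 : unitInterval) else u e)).real (openConn a₀ b) ≤ (prodBernoulli (fun e : Sym2 (Fin n) => if ∃ y ∈ S, y ∈ e then (0 : unitInterval) else u e)).real (openConn a b)) ∧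
        (∀ s ∈ S, ∀ z : Fin n, z ∉ S → (u s(s, z) : ℝ) ≠ 0 →
          (prodBernoulli (fun e : Sym2 (Fin n) => if ∃ y ∈ S, y ∈ e then (0 : unitInterval) else u e)).real (openConn a₀ b) ≤ (prodBernoulli (fun e : Sym2 (Fin n) => if ∃ y ∈ S, y ∈ e then (0 : unitInterval) else u e)).real (openConn z b)))) :
    Summit.CriticalPhenomena.PercolationContinuityZ3.Theses.PercNearOneGluing.AdditiveGluing :=
  additiveGluing_of_residualKernelQ9 (residualKernelQ9_of_LC hLC)

end LC

open Filter Literature.Probability.LatticeModels Literature.Probability.Percolation in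
/-- Registered helper stub `stub_additiveGluingOfLC_xfa` (invested seat xfam-a): the crux `AdditiveGluing` BY NAME from LEAF-COMPLETENESS
(= `additiveGluing_of_LC`). [cite: KozmaNitzan2024, §3.2 (Thms 4–5 pp. 12–14), Question 9 (p. 36)] -/
theorem stub_additiveGluingOfLC_xfa : (∀ (n : ℕ) (u : Sym2 (Fin n) → unitInterval) (A S : Finset (Fin n)) (b a₀ : Fin n) (sel : Finset (Fin n) → Fin n), b ∈ A → Disjoint S A → 2 ≤ S.card → 4 ≤ A.card → (∀ W, sel W ∈ A) → a₀ ∈ A → (∀ a ∈ A, (prodBernoulli u).real (openConn a₀ b) ≤ (prodBernoulli u).real (openConn a b)) → (∀ v ∈ S, (prodBernoulli u).real (openConn v b) < (prodBernoulli u).real (openConn a₀ b)) → (∃ a ∈ A, (prodBernoulli (fun e : Sym2 (Fin n) => if (∀ x ∈ e, x ∈ S) ∧ ¬ e.IsDiag then 1 else u e)).real (openConn a b) < (prodBernoulli (fun e : Sym2 (Fin n) => if (∀ x ∈ e, x ∈ S) ∧ ¬ e.IsDiag then 1 else u e)).real (openConn a₀ b)) → ( (prodBernoulli (fun e : Sym2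 (Fin n) => if (∀ x ∈ e, x ∈ S) ∧ ¬ e.IsDiag then 1 else u e)).real (openConn a₀ b) ≤ (prodBernoulli u).real (⋃ s ∈ S, openConn s b)) ∨ ( ∃ v ∈ S, (prodBernoulli u).real (openConn a₀ v)ᶜ ≠ 0 ∧ max ((prodBernoulli u).real (openConn a₀ b) - (prodBernoulli u).real (openConn v b)) 0 * (prodBernoulli (fun e : Sym2 (Fin n) => if (∀ x ∈ e, x ∈ S) ∧ ¬ e.IsDiag then 1 else u e)).real (openConn a₀ v)ᶜ ≤ (prodBernoulli u).real (openConn a₀ v)ᶜ * (∑ W ∈ (Finset.univ : Finset (Finset (Fin n))).filter (fun W => Disjoint W A), (prodBernoulli u).real {ω : BondConfig (Fin n) | ∀ z : Fin n, (z ∈ W ↔ ω ∈ ⋃ s ∈ S, openConn s z)} * (prodBernoulli u).real (openConnIn ((W : Set (Fin n))ᶜ) (sel W) b))) ∨ ( ∀ a ∈ A, (prodBernoulli (fun e : Sym2 (Fin n) => if (∀ x ∈ e, x ∈ S) ∧ ¬ e.IsDiag then 1 else u e)).real (openConn a₀ b) ≤ (prodBernoulli (fun e : Sym2 (Fin n)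 => if (∀ x ∈ e, x ∈ S) ∧ ¬ e.IsDiag then 1 else u e)).real (openConn a b)) ∨ ( ∃ x ∈ S, ∃ a' ∈ A, (∀ a ∈ A, (prodBernoulli (fun e : Sym2 (Fin n) => if x ∈ e then (0 : unitInterval) else (fun e : Sym2 (Fin n) => if (∀ x ∈ e, x ∈ S) ∧ ¬ e.IsDiag then 1 else u e) e)).real (openConn a' b) ≤ (prodBernoulli (fun e : Sym2 (Fin n) => if x ∈ e then (0 : unitInterval) else (fun e : Sym2 (Fin n) => if (∀ x ∈ e, x ∈ S) ∧ ¬ e.IsDiag then 1 else u e) e)).real (openConn a b)) ∧ (prodBernoulli (fun e : Sym2 (Fin n) => if (∀ x ∈ e, x ∈ S) ∧ ¬ e.IsDiag then 1 else u e)).real (openConn a₀ b) ≤ (prodBernoulli (fun e : Sym2 (Fin n) => if (∀ x ∈ e, x ∈ S) ∧ ¬ e.IsDiag then 1 else u e)).real (openConn a' b)) ∨ ( (∀ a ∈ A, (prodBernoulli (fun e : Sym2 (Fin n) => if ∃ y ∈ S, y ∈ e then (0 : unitInterval) else u e)).real (openConn a₀ b) ≤ (prodBernoulli (fun e : Sym2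 (Fin n) => if ∃ y ∈ S, y ∈ e then (0 : unitInterval) else u e)).real (openConn a b)) ∧ (∀ s ∈ S, ∀ z : Fin n, z ∉ S → (u s(s, z) : ℝ) ≠ 0 → (prodBernoulli (fun e : Sym2 (Fin n) => if ∃ y ∈ S, y ∈ e then (0 : unitInterval) else u e)).real (openConn a₀ b) ≤ (prodBernoulli (fun e : Sym2 (Fin n) => if ∃ y ∈ S, y ∈ e then (0 : unitInterval) else u e)).real (openConn z b)))) → Summit.CriticalPhenomena.PercolationContinuityZ3.Theses.PercNearOneGluing.AdditiveGluing :=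
  additiveGluing_of_LC

end

end Summit.CriticalPhenomena.PercolationContinuityZ3.Theorems
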